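import Summits.RiemannHypothesis.RiemannHypothesis.Theorems.SemilocalNegCertPieces
import Summits.RiemannHypothesis.RiemannHypothesis.Theorems.SemilocalLogAtoms
import HarnessLib

/-!
# Semi-local threshold of the `{∞,2,3,5,7}` form, negative side: `a*({2,3,5,7}) ≤ 61/50 = 1.22`

Cell `rh-explicit` (HOME `run/shared/lean/pub/rh-explicit/`), seat cc-s2-4 gen7 (A4 SEMILOCAL-TABLE row `{∞,2,3,5,7}`, the
class `2, 3, 5, 7 ∈ S ∌ 11`).  Honest framing: theorems about the tree's `weilSemilocalThreshold S` (WHERE the `S`-truncated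
positivity of the Connes–Consani programme stops); nothing here bears on RH.  No data is trusted: seven kernel facts
(`decide +kernel`, a few seconds each) of the PIECEWISE certificate `certSeven122` (`WeilNegCertP`, `SemilocalNegCertPieces.lean`;
window `2b = 2.44 > 2` is beyond the reach of `WeilNegCertS`).

Instance data: `S = {2,3,5,7}`, window `N = 12` (`b < (log 13)/2`), atoms = the `S`-smooth prime powers `≤ 12`:
`2, 3, 4, 5, 7, 8, 9` (`atomsSeven`; enclosures `SemilocalLogAtoms.lean`, incl. `log 7` to 11 decimals).  Witness (lineage B of
the A4 table = cc-s2-5's Legendre/exact-moment engine, bottom vector of the odd Legendre section `d = 11` at `b = 61/50`,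
rounded; certified independently by `witness_exact.py`): `Re Q_S(G)/‖G‖² = −1.4145…·10⁻³` ⇒
**`weilSemilocalThreshold {2,3,5,7} ≤ 61/50`** (kernel margin `1.412·10⁻³`; bulk `(0, 2.44]` in five pieces cut at
`1, 3/2, 19/10, 11/5`, majorant `archMajorCL 10 3 5 u₀`).  Locality (`N = 12`; prime powers `≤ 12`: `2,3,4,5,7,8,9,11`):
**`a*(S) = a*({2,3,5,7}) ∈ [0.8046, 1.22]` for every finite `S` with `2, 3, 5, 7 ∈ S`, `11 ∉ S`** (DATA, one engine
certified: `a* ≤ 1.1995`, float `≈ 1.1995`).  Folklore throughout.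
-/

set_option autoImplicit false
set_option linter.dupNamespace false  -- the mandated namespace repeats `RiemannHypothesis`

noncomputable section

open Complex Filter Set MeasureTheory Topology
open scoped Real

namespace Summit.RiemannHypothesis.RiemannHypothesis.Theorems.SemilocalPolyWitness

open MeasureTheory Set Finset Real
open Literature.NumberTheory.LFunctions
open Summit.RiemannHypothesis.RiemannHypothesis.Theorems.MotivicDoor
open Summit.RiemannHypothesis.RiemannHypothesis.Theorems.MotivicDoor.SemilocalThreshold
open Summit.RiemannHypothesis.RiemannHypothesis.Theorems.MotivicDoor.SemilocalMarkov
open LQ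


/-! ### The atom table of the `{2, 3, 5, 7}`-form on windows `b < (log 13)/2` (`N = 12`) -/

/-- The atoms of the `{2, 3, 5, 7}`-form below `(log 13)/2`: `2, 3, 4, 5, 7, 8, 9`. -/
def atomsSeven : List (ℕ × AtomQ) := [atomTwo, atomThree, atomFour, atomFive, atomSeven, atomEight, atomNine]

/-- A rational lower bound of `log 13`. -/
def logSuccLoSeven : ℚ := logThirteenLo

/-- **The atom table encloses `({2, 3, 5, 7}, 12)`.** -/
theorem atomsEnclose_Seven : AtomsEnclose {2, 3, 5, 7} 12 atomsSeven logSuccLoSeven where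
  nodup := by decide
  lt_succ := by decide
  cover := by
    intro n hn hnot
    simp only [atomsSeven, atomTwo, atomThree, atomFour, atomFive, atomSeven, atomEight, atomNine, List.map_cons, List.map_nil, List.mem_cons,
      List.not_mem_nil, or_false, not_or] at hnot
    have hn' : n < 13 := Finset.mem_range.1 hn
    interval_cases n
    · exact weilSemilocalCoeff_of_not_isPrimePow _ (by decide)
    · exact weilSemilocalCoeff_of_not_isPrimePow _ (by decide)
    · simp at hnot
    · simp at hnot
    · simp at hnot
    · simp at hnot
    · exact weilSemilocalCoeff_of_not_isPrimePow _ (by decide)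
    · simp at hnot
    · simp at hnot
    · simp at hnot
    · exact weilSemilocalCoeff_of_not_isPrimePow _ (by decide)
    · exact weilSemilocalCoeff_prime_of_not_mem (by norm_num) (by decide)
    · exact weilSemilocalCoeff_of_not_isPrimePow _ (by decide)
  encl := by
    intro na hna
    simp only [atomsSeven, List.mem_cons, List.not_mem_nil, or_false] at hna
    rcases hna with rfl | rfl | rfl | rfl | rfl | rfl | rfl
    · exact atomTwo_encl (by decide)
    · exact atomThree_encl (by decide)
    · exact atomFour_encl (by decide)
    · exact atomFive_encl (by decide)
    · exact atomSeven_encl (by decide)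
    · exact atomEight_encl (by decide)
    · exact atomNine_encl (by decide)
  logSucc := by
    have h := logThirteenLo_le
    norm_num
    exact h

/-! ### The certificates -/

/-- The degree-11 witness at `b = 61 / 50` (bottom vector of the odd Legendre section d = 11, rounded to 8 digits; lineage-B certified margin Re Q_S/‖G‖² = −1.4145·10⁻³), in powers of `x`. -/
def pSeven122 : List ℚ :=
  [0, 2118188241475 / 7808, 0, -26070027026640625 / 7263392, 0, 40728727308076171875 / 3378385204, 0, -49495673783184814453125 / 3142742836021, 0, 105365771533317565917968750 / 11694146092834141, 0, -82872408272037506103515625000 / 43513917611435838661]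

/-- The piecewise certificate at `b = 61 / 50`: orders `(nA, mA, KA, Kt, nt, ne) = (10, 3, 5, 10, 40, 16)`, cuts `[1, 3 / 2, 19 / 10, 11 / 5, 61 / 25]`,
claimed piece bounds and atom bound (exact rational values rounded up to integers). -/
def certSeven122 : WeilNegCertP :=
  ⟨pSeven122, 61 / 50, 10, 3, 5, 10, 40, 16, atomsSeven, logSuccLoSeven,
   [1, 3 / 2, 19 / 10, 11 / 5, 61 / 25],
   [16313387361276694, 4111106215420811, 2792363930560712, 1959510314881964, 1091740602092539], 53831309093521583⟩

set_option maxHeartbeats 0 in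
/-- kernel fact: side conditions and the final inequality of `certSeven122`. -/
theorem check_Seven122_main : certSeven122.checkMain c0SharpQ = true := by
  decide +kernel

set_option maxHeartbeats 0 in
/-- kernel fact: the atom side of `certSeven122`. -/
theorem check_Seven122_atoms : certSeven122.checkAtoms = true := by
  decide +kernel

set_option maxHeartbeats 0 in
/-- kernel fact: piece `0` of `certSeven122`. -/
theorem check_Seven122_piece0 : certSeven122.checkPiece 0 = true := by
  decide +kernel

set_option maxHeartbeats 0 in
/-- kernel fact: piece `1` of `certSeven122`. -/
theorem check_Seven122_piece1 : certSeven122.checkPiece 1 = true := by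
  decide +kernel

set_option maxHeartbeats 0 in
/-- kernel fact: piece `2` of `certSeven122`. -/
theorem check_Seven122_piece2 : certSeven122.checkPiece 2 = true := by
  decide +kernel

set_option maxHeartbeats 0 in
/-- kernel fact: piece `3` of `certSeven122`. -/
theorem check_Seven122_piece3 : certSeven122.checkPiece 3 = true := by
  decide +kernel

set_option maxHeartbeats 0 in
/-- kernel fact: piece `4` of `certSeven122`. -/
theorem check_Seven122_piece4 : certSeven122.checkPiece 4 = true := by
  decide +kernel

/-- all pieces of `certSeven122` check. -/
theorem check_Seven122_pieces : ∀ i, i < certSeven122.cuts.length → certSeven122.checkPiece i = true := by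
  intro i hi
  have hi' : i < 5 := hi
  interval_cases i
  · exact check_Seven122_piece0
  · exact check_Seven122_piece1
  · exact check_Seven122_piece2
  · exact check_Seven122_piece3
  · exact check_Seven122_piece4

/-! ### The theorems -/

/-- **`a*({2,3,5,7}) ≤ 61/50 = 1.22`.** -/
theorem weilSemilocalThreshold_uptoSeven_le_122 :
    weilSemilocalThreshold {2, 3, 5, 7} ≤ ((61 / 50 : ℚ) : ℝ) :=
  weilSemilocalThreshold_le_of_checkP_sharp certSeven122 atomsEnclose_Seven
    check_Seven122_main check_Seven122_atoms check_Seven122_pieces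

/-- Failure form: `{∞,2,3,5,7}`-positivity fails on every cone `C(B)`, `B > 61/50`. -/
theorem not_weilSemilocalPositivityOn_uptoSeven_of_gt {B : ℝ} (hB : (61 / 50 : ℝ) < B) :
    ¬ WeilSemilocalPositivityOn {2, 3, 5, 7} B := by
  rw [not_weilSemilocalPositivityOn_iff_weilSemilocalThreshold_lt]
  have h := weilSemilocalThreshold_uptoSeven_le_122
  push_cast at h
  linarith

/-- `a*({2,3,5,7}) < (log 13)/2`: below the window where the prime `13` would enter. -/
theorem weilSemilocalThreshold_uptoSeven_lt_log_thirteen_half :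
    weilSemilocalThreshold {2, 3, 5, 7} < Real.log 13 / 2 := by
  have h := weilSemilocalThreshold_uptoSeven_le_122
  have h13 := log_thirteen_gt_d11
  push_cast at h
  linarith

/-- **The class `2, 3, 5, 7 ∈ S ∌ 11`**: `a*(S) = a*({2,3,5,7})` (locality at `N = 12`). -/
theorem weilSemilocalThreshold_eq_uptoSeven {S : Finset ℕ} (h2 : 2 ∈ S) (h3 : 3 ∈ S) (h5 : 5 ∈ S) (h7 : 7 ∈ S)
    (h11 : 11 ∉ S) : weilSemilocalThreshold S = weilSemilocalThreshold {2, 3, 5, 7} := by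
  refine weilSemilocalThreshold_congr (S := {2, 3, 5, 7}) (S' := S) (N := 12) ?_ ?_
  · intro n hn hpp
    interval_cases n
    · exact absurd hpp (by decide)
    · exact absurd hpp (by decide)
    · rw [Nat.prime_two.primeFactors]; simp [h2]
    · rw [Nat.prime_three.primeFactors]; simp [h3]
    · rw [show (4 : ℕ) = 2 ^ 2 by norm_num, Nat.primeFactors_prime_pow two_ne_zero Nat.prime_two]; simp [h2]
    · rw [(by norm_num : Nat.Prime 5).primeFactors]; simp [h5]
    · exact absurd hpp (by decide)
    · rw [(by norm_num : Nat.Prime 7).primeFactors]; simp [h7]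
    · rw [show (8 : ℕ) = 2 ^ 3 by norm_num, Nat.primeFactors_prime_pow (by norm_num) Nat.prime_two]; simp [h2]
    · rw [show (9 : ℕ) = 3 ^ 2 by norm_num, Nat.primeFactors_prime_pow two_ne_zero Nat.prime_three]; simp [h3]
    · exact absurd hpp (by decide)
    · rw [(by norm_num : Nat.Prime 11).primeFactors]; simp [h11]
    · exact absurd hpp (by decide)
  · have h := weilSemilocalThreshold_uptoSeven_lt_log_thirteen_half
    norm_num
    exact h

/-- **`a*(S) ≤ 61/50` for every finite set of primes `S` with `2, 3, 5, 7 ∈ S`, `11 ∉ S`.** -/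
theorem weilSemilocalThreshold_le_122_of_mem {S : Finset ℕ} (h2 : 2 ∈ S) (h3 : 3 ∈ S) (h5 : 5 ∈ S) (h7 : 7 ∈ S)
    (h11 : 11 ∉ S) : weilSemilocalThreshold S ≤ ((61 / 50 : ℚ) : ℝ) := by
  rw [weilSemilocalThreshold_eq_uptoSeven h2 h3 h5 h7 h11]
  exact weilSemilocalThreshold_uptoSeven_le_122

/-- **The bracket of the class `2, 3, 5, 7 ∈ S ∌ 11`**: `4023/5000 ≤ a*(S) ≤ 61/50` (DATA `≈ 1.1995`). -/
theorem weilSemilocalThreshold_mem_Icc_of_mem_seven {S : Finset ℕ} (h2 : 2 ∈ S) (h3 : 3 ∈ S) (h5 : 5 ∈ S)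
    (h7 : 7 ∈ S) (h11 : 11 ∉ S) : weilSemilocalThreshold S ∈ Set.Icc (4023 / 5000 : ℝ) ((61 / 50 : ℚ) : ℝ) :=
  ⟨SemilocalTwoThree.le_weilSemilocalThreshold_of_two_three_8046 h2 h3,
    weilSemilocalThreshold_le_122_of_mem h2 h3 h5 h7 h11⟩

end Summit.RiemannHypothesis.RiemannHypothesis.Theorems.SemilocalPolyWitness

end

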